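import Summits.Ventures.LatticeQCDFlow.TrivializingMaps.FlowTauIntFloorAnyGroup
import Summits.Ventures.LatticeQCDFlow.TrivializingMaps.FlowAutocorrelationAction
import Summits.Ventures.LatticeQCDFlow.Scaling.FlowReachLaw

/-!
HONEST FRAMING: exact (Metropolis-corrected) sampling algorithms for lattice gauge theory; figures
of merit are autocorrelation/cost numbers at stated couplings and volumes; no continuum-physics
claim.

# FlowTauIntAllCouplings — `τ_int` OF AN EXACT FLOW SAMPLER OF THE WILSON MEASURE IS EXPONENTIAL IN THE VOLUME
# AT EVERY COUPLING FOR A MODEL WITHIN A FACTOR OF THE HAAR PRIOR: EVERY BOUNDED OBSERVABLE, AND THE PLAQUETTE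
# ITSELF — EVERY COMPACT GAUGE GROUP (lean-2 GEN-13, ours)

Venture-side (OURS).  Cell `lqcd-flow` (pub-lqcd), unit `pub-lqcd-lean-2-g13`, 2026-08-23.  Companion of
`TrivializingMaps/FlowTauIntFloorAnyGroup.lean` (the reciprocity law `τ_int(g) ≥ E_β[g²]/(B²·acc) − ½` for the
cell's figure of merit `Scoring.tauInt`): here GEN-11's acceptance ceiling
`acc ≤ C·exp(−e^{−β·2NK(1+4K)}⌊L/2⌋^d·Var_Haar(Re tr ρ)·β²/4)` (`Scaling/FlowAcceptanceCeiling`, model density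
`0 ≤ q ≤ C` over `D[U]`, unitary `ρ`, `d ≥ 2`, `L ≥ 2`, `β ≥ 0`) is inserted, for models that also COVER the
target (`p_β ≤ C'·q`, so that the autocorrelation series is summable and `τ_int` is the honest sum).

## What is proved (every compact `G`, continuous unitary `ρ`, `d ≥ 2`, `L ≥ 2`, `β ≥ 0`, `K = (d+1)d²`;
measurable model density `0 < q ≤ C`, `∫ q dD[U] = 1`, `p_β ≤ C'·q`)

* **`wilson_flow_tauInt_ge_allCouplings`** — for every bounded measurable centred `g` (`|g| ≤ B`,
  `E_{μ_β}[g] = 0`, `E_{μ_β}[g²] > 0`):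
  `E_{μ_β}[g²]·exp(e^{−β·2NK(1+4K)}·⌊L/2⌋^d·Var_Haar(Re tr ρ)·β²/4)/(B²·C) − ½ ≤ τ_int(ρ_g)`;
* **`wilson_flow_tauInt_ge_reach`** — a model anchored at coupling `a` (`q ≤ C·p_a`) and run at `b`
  (`−B ≤ a ≤ b ≤ B`, `p_b ≤ C'·q`):
  `E_{μ_b}[g²]·exp(e^{−B·2NK(1+4K)}·⌊L/2⌋^d·Var_Haar(Re tr ρ)·(b−a)²/4)/(B_g²·C) − ½ ≤ τ_int(ρ_g)` (GEN-11's
  reach ceiling `Scaling/FlowReachLaw`);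
* **`wilson_flow_action_tauInt_ge_allCouplings`** — the Wilson action (`Var_Haar(Re tr ρ) > 0`,
  `g = S_W − ⟨S_W⟩_β`, `|g| ≤ 2N·#plaq`, `E_β[g²] = Var_β(S_W) ≥ m`):
  `m·exp(m·β²/4)/((2N·#plaq)²·C) − ½ ≤ τ_int(ρ_{S_W})`, `m = e^{−β·2NK(1+4K)}·⌊L/2⌋^d·Var_Haar(Re tr ρ)` GEN-9's
  all-coupling variance floor (`TrivializingMaps/WilsonVarianceFloorAllCouplings`).

Reading (no numerics implied): an exact flow sampler whose model density stays within a factor `C` of the Haar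
prior has, at every `β > 0`, an integrated autocorrelation time at least `e^{c(β)·volume}/C` times the
observable's normalised variance — for the plaquette at least `m·e^{mβ²/4}/((2N·#plaq)²·C)`, exponential in the
volume against a polynomial prefactor; decorrelation in `O(1)` steps REQUIRES `log C ≳ c(β)·volume`.  The
covering constant `C'` does not enter the floor (it only makes `τ_int` finite).  NOT CLAIMED: anything about a
specific architecture, its constants or training cost; unbounded observables; the continuum.  Literature grade
(cell rule): KNOWN MECHANISM (Liu 1996; Mengersen–Tweedie 1996), NEW TYPING; nothing cited as a fact.
-/

noncomputable section

open MeasureTheory ProbabilityTheory Real Set Filter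
open Literature.MathematicalPhysics.QuantumFieldTheory
open Literature.MathematicalPhysics.QuantumFieldTheory.Luscher2010
open Summit.Ventures.LatticeQCDFlow.Exactness
open Summit.Ventures.LatticeQCDFlow.Scaling
open Summit.Ventures.LatticeQCDFlow.Scoring

namespace Summit.Ventures.LatticeQCDFlow.TrivializingMaps

section Wilson

variable {d L N : ℕ} [NeZero L] {G : Type*} [Group G] [TopologicalSpace G] [IsTopologicalGroup G]
  [CompactSpace G] [MeasurableSpace G] [BorelSpace G] [SecondCountableTopology G]
  (ρ : G →* Matrix (Fin N) (Fin N) ℂ)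

/-- **AT EVERY COUPLING, EXPLICITLY — `τ_int` EXPONENTIAL IN THE VOLUME** (unitary `ρ`, `d ≥ 2`, `L ≥ 2`, `β ≥ 0`;
model density `0 < q ≤ C` over `D[U]` covering the target, `p_β ≤ C'·q`; bounded measurable centred `g` with
`E_{μ_β}[g²] > 0`): `E_{μ_β}[g²]·exp(e^{−β·2NK(1+4K)}·⌊L/2⌋^d·Var_Haar(Re tr ρ)·β²/4)/(B²·C) − ½ ≤ τ_int(ρ_g)`,
`K = (d+1)d²` (GEN-11's acceptance ceiling `acc ≤ C·exp(−…)` inside the reciprocity law). [ours] -/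
theorem wilson_flow_tauInt_ge_allCouplings (hd : 2 ≤ d) (hL : 2 ≤ L) (hρ : Continuous ρ)
    (hρu : ∀ g, ρ g ∈ Matrix.unitaryGroup (Fin N) ℂ) {β : ℝ} (hβ : 0 ≤ β)
    {q : GaugeConfig d L G → ℝ} (hqm : Measurable q) (hq0 : ∀ U, 0 < q U) {C : ℝ} (hqC : ∀ U, q U ≤ C)
    (hq1 : ∫ U, q U ∂(trivialMeasure G d L) = 1) {C' : ℝ}
    (hC : ∀ U, exp (β * (-wilsonAction ρ U)) / mgf (fun U => -wilsonAction ρ U) (trivialMeasure G d L) β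
      ≤ C' * q U)
    {g : GaugeConfig d L G → ℝ} (hgm : Measurable g) {B : ℝ} (hgb : ∀ U, |g U| ≤ B)
    (hg0 : ∫ U, g U ∂(wilsonMeasure (d := d) (L := L) ρ β) = 0)
    (hpos : 0 < ∫ U, g U ^ 2 ∂(wilsonMeasure (d := d) (L := L) ρ β)) :
    (∫ U, g U ^ 2 ∂(wilsonMeasure (d := d) (L := L) ρ β)) *
        exp (Real.exp (-(β * (2 * N * ((d + 1) * d ^ 2 : ℕ) * (1 + 4 * ((d + 1) * d ^ 2 : ℕ))))) *
          ((L / 2) ^ d : ℕ) * variance (fun g => (ρ g).trace.re) (haarProbability G) * β ^ 2 / 4) /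
        (B ^ 2 * C) - 1 / 2 ≤
      tauInt (fun n => (∫ U, g U * ((imhOp (trivialMeasure G d L)
          (fun U => exp (β * (-wilsonAction ρ U)) / mgf (fun U => -wilsonAction ρ U) (trivialMeasure G d L) β)
          q)^[n] g) U ∂(wilsonMeasure (d := d) (L := L) ρ β)) /
        ∫ U, g U ^ 2 ∂(wilsonMeasure (d := d) (L := L) ρ β)) := by
  have hacc := wilson_flowAcc_le_allCouplings (d := d) (L := L) ρ hd hL hρ hρu hβ hqm
    (fun U => (hq0 U).le) hqC
  have haccpos := wilson_flowAcc_pos (d := d) (L := L) ρ hρ β hqm hq0 hq1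
  refine le_trans ?_ (wilson_flow_tauInt_twoSided ρ hρ β hqm hq0 hq1 hC hgm hgb hg0 hpos).1
  -- `B ≠ 0` (else `g = 0` contradicts `E_β[g²] > 0`)
  have hB : 0 < B ^ 2 := by
    rcases (sq_nonneg B).eq_or_lt with h | h
    · exfalso
      have hB0 : B = 0 := by
        have := sq_eq_zero_iff.1 h.symm
        exact this
      have hg : ∀ U, g U = 0 := fun U => abs_nonpos_iff.1 (hB0 ▸ hgb U)
      simp only [hg, ne_eq, OfNat.ofNat_ne_zero, not_false_eq_true, zero_pow, integral_zero,
        lt_self_iff_false] at hpos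
    · exact h
  set κ : ℝ := Real.exp (-(β * (2 * N * ((d + 1) * d ^ 2 : ℕ) * (1 + 4 * ((d + 1) * d ^ 2 : ℕ))))) *
    ((L / 2) ^ d : ℕ) * variance (fun g => (ρ g).trace.re) (haarProbability G) * β ^ 2 / 4 with hκ
  set acc : ℝ := ∫ z, min (exp (β * (-wilsonAction ρ z.1)) /
        mgf (fun U => -wilsonAction ρ U) (trivialMeasure G d L) β * q z.2)
      (exp (β * (-wilsonAction ρ z.2)) /
        mgf (fun U => -wilsonAction ρ U) (trivialMeasure G d L) β * q z.1)
      ∂((trivialMeasure G d L).prod (trivialMeasure G d L)) with hacc_def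
  set E : ℝ := ∫ U, g U ^ 2 ∂(wilsonMeasure (d := d) (L := L) ρ β) with hE
  refine sub_le_sub_right ?_ _
  -- `E·e^{κ}/(B²C) ≤ E/(B²·acc)` since `acc ≤ C·e^{−κ}`
  have hCpos : 0 < C := (hq0 (Classical.arbitrary _)).trans_le (hqC _)
  have h1 : B ^ 2 * acc ≤ B ^ 2 * C * exp (-κ) := by
    rw [mul_assoc]
    exact mul_le_mul_of_nonneg_left hacc hB.le
  calc E * exp κ / (B ^ 2 * C) = E / (B ^ 2 * C * exp (-κ)) := by
        rw [Real.exp_neg]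
        field_simp
    _ ≤ E / (B ^ 2 * acc) := div_le_div_of_nonneg_left hpos.le (mul_pos hB haccpos) h1

/-- **REACH FORM — A MODEL ANCHORED AT COUPLING `a`, RUN AT `b`** (unitary `ρ`, `d ≥ 2`, `L ≥ 2`,
`−B ≤ a ≤ b ≤ B`; model density `0 < q ≤ C·p_a` over `D[U]`, `∫ q dD[U] = 1`, covering the target `p_b ≤ C'·q`;
bounded measurable centred `g` with `E_{μ_b}[g²] > 0`):
`E_{μ_b}[g²]·exp(e^{−B·2NK(1+4K)}·⌊L/2⌋^d·Var_Haar(Re tr ρ)·(b−a)²/4)/(B_g²·C) − ½ ≤ τ_int(ρ_g)` — an exact flow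
sampler trained (to within a factor `C`) at coupling `a` and deployed at `b` has an integrated autocorrelation
time at least Gaussian-LARGE in `(b−a)·√volume` (GEN-11's reach ceiling `Scaling/FlowReachLaw` inside the
reciprocity law). [ours] -/
theorem wilson_flow_tauInt_ge_reach (hd : 2 ≤ d) (hL : 2 ≤ L) (hρ : Continuous ρ)
    (hρu : ∀ g, ρ g ∈ Matrix.unitaryGroup (Fin N) ℂ) {a b B : ℝ} (ha : -B ≤ a) (hab : a ≤ b) (hb : b ≤ B)
    {q : GaugeConfig d L G → ℝ} (hqm : Measurable q) (hq0 : ∀ U, 0 < q U) {C : ℝ}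
    (hqC : ∀ U, q U ≤ C * (exp (a * (-wilsonAction ρ U)) /
      mgf (fun U => -wilsonAction ρ U) (trivialMeasure G d L) a))
    (hq1 : ∫ U, q U ∂(trivialMeasure G d L) = 1) {C' : ℝ}
    (hC : ∀ U, exp (b * (-wilsonAction ρ U)) / mgf (fun U => -wilsonAction ρ U) (trivialMeasure G d L) b
      ≤ C' * q U)
    {g : GaugeConfig d L G → ℝ} (hgm : Measurable g) {Bg : ℝ} (hgb : ∀ U, |g U| ≤ Bg)
    (hg0 : ∫ U, g U ∂(wilsonMeasure (d := d) (L := L) ρ b) = 0)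
    (hpos : 0 < ∫ U, g U ^ 2 ∂(wilsonMeasure (d := d) (L := L) ρ b)) :
    (∫ U, g U ^ 2 ∂(wilsonMeasure (d := d) (L := L) ρ b)) *
        exp (Real.exp (-(B * (2 * N * ((d + 1) * d ^ 2 : ℕ) * (1 + 4 * ((d + 1) * d ^ 2 : ℕ))))) *
          ((L / 2) ^ d : ℕ) * variance (fun g => (ρ g).trace.re) (haarProbability G) * (b - a) ^ 2 / 4) /
        (Bg ^ 2 * C) - 1 / 2 ≤
      tauInt (fun n => (∫ U, g U * ((imhOp (trivialMeasure G d L)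
          (fun U => exp (b * (-wilsonAction ρ U)) / mgf (fun U => -wilsonAction ρ U) (trivialMeasure G d L) b)
          q)^[n] g) U ∂(wilsonMeasure (d := d) (L := L) ρ b)) /
        ∫ U, g U ^ 2 ∂(wilsonMeasure (d := d) (L := L) ρ b)) := by
  have hacc := wilson_flowReach_le_allCouplings (d := d) (L := L) ρ hd hL hρ hρu ha hab hb hqm
    (fun U => (hq0 U).le) hqC
  have haccpos := wilson_flowAcc_pos (d := d) (L := L) ρ hρ b hqm hq0 hq1
  refine le_trans ?_ (wilson_flow_tauInt_twoSided ρ hρ b hqm hq0 hq1 hC hgm hgb hg0 hpos).1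
  have hB : 0 < Bg ^ 2 := by
    rcases (sq_nonneg Bg).eq_or_lt with h | h
    · exfalso
      have hB0 : Bg = 0 := sq_eq_zero_iff.1 h.symm
      have hg : ∀ U, g U = 0 := fun U => abs_nonpos_iff.1 (hB0 ▸ hgb U)
      simp only [hg, ne_eq, OfNat.ofNat_ne_zero, not_false_eq_true, zero_pow, integral_zero,
        lt_self_iff_false] at hpos
    · exact h
  set κ : ℝ := Real.exp (-(B * (2 * N * ((d + 1) * d ^ 2 : ℕ) * (1 + 4 * ((d + 1) * d ^ 2 : ℕ))))) *
    ((L / 2) ^ d : ℕ) * variance (fun g => (ρ g).trace.re) (haarProbability G) * (b - a) ^ 2 / 4 with hκ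
  set acc : ℝ := ∫ z, min (exp (b * (-wilsonAction ρ z.1)) /
        mgf (fun U => -wilsonAction ρ U) (trivialMeasure G d L) b * q z.2)
      (exp (b * (-wilsonAction ρ z.2)) /
        mgf (fun U => -wilsonAction ρ U) (trivialMeasure G d L) b * q z.1)
      ∂((trivialMeasure G d L).prod (trivialMeasure G d L)) with hacc_def
  set E : ℝ := ∫ U, g U ^ 2 ∂(wilsonMeasure (d := d) (L := L) ρ b) with hE
  refine sub_le_sub_right ?_ _
  have hCpos : 0 < C := by
    haveI : IsProbabilityMeasure (trivialMeasure G d L) := trivialMeasure_isProbabilityMeasure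
    have hpa : 0 < exp (a * (-wilsonAction ρ (Classical.arbitrary (GaugeConfig d L G)))) /
        mgf (fun U => -wilsonAction ρ U) (trivialMeasure G d L) a :=
      div_pos (exp_pos _) (mgf_pos (integrable_trivialMeasure_of_continuous_group
        (continuous_exp.comp (continuous_const.mul (continuous_wilsonAction_of_continuous ρ hρ).neg))))
    have hq := hq0 (Classical.arbitrary (GaugeConfig d L G))
    have hqc := hqC (Classical.arbitrary (GaugeConfig d L G))
    by_contra h
    push Not at h
    nlinarith
  have h1 : Bg ^ 2 * acc ≤ Bg ^ 2 * C * exp (-κ) := by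
    rw [mul_assoc]
    exact mul_le_mul_of_nonneg_left hacc hB.le
  calc E * exp κ / (Bg ^ 2 * C) = E / (Bg ^ 2 * C * exp (-κ)) := by
        rw [Real.exp_neg]
        field_simp
    _ ≤ E / (Bg ^ 2 * acc) := div_le_div_of_nonneg_left hpos.le (mul_pos hB haccpos) h1

/-- **THE PLAQUETTE ITSELF — `τ_int(S_W)` EXPONENTIAL IN THE VOLUME AT EVERY COUPLING** (unitary `ρ`, `d ≥ 2`,
`L ≥ 2`, `β ≥ 0`, `Var_Haar(Re tr ρ) > 0`; model density `0 < q ≤ C` with `∫ q dD[U] = 1` and `p_β ≤ C'·q`):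
with `m = e^{−β·2NK(1+4K)}·⌊L/2⌋^d·Var_Haar(Re tr ρ)` (GEN-9's all-coupling variance floor) and
`g = S_W − ⟨S_W⟩_β`: `m·exp(m·β²/4)/((2N·#plaq)²·C) − ½ ≤ τ_int(ρ_{S_W})`. [ours] -/
theorem wilson_flow_action_tauInt_ge_allCouplings (hd : 2 ≤ d) (hL : 2 ≤ L) (hρ : Continuous ρ)
    (hρu : ∀ g, ρ g ∈ Matrix.unitaryGroup (Fin N) ℂ)
    (hv : 0 < variance (fun g => (ρ g).trace.re) (haarProbability G)) {β : ℝ} (hβ : 0 ≤ β)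
    {q : GaugeConfig d L G → ℝ} (hqm : Measurable q) (hq0 : ∀ U, 0 < q U) {C : ℝ} (hqC : ∀ U, q U ≤ C)
    (hq1 : ∫ U, q U ∂(trivialMeasure G d L) = 1) {C' : ℝ}
    (hC : ∀ U, exp (β * (-wilsonAction ρ U)) / mgf (fun U => -wilsonAction ρ U) (trivialMeasure G d L) β
      ≤ C' * q U) :
    (Real.exp (-(β * (2 * N * ((d + 1) * d ^ 2 : ℕ) * (1 + 4 * ((d + 1) * d ^ 2 : ℕ))))) *
          ((L / 2) ^ d : ℕ) * variance (fun g => (ρ g).trace.re) (haarProbability G)) *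
        exp ((Real.exp (-(β * (2 * N * ((d + 1) * d ^ 2 : ℕ) * (1 + 4 * ((d + 1) * d ^ 2 : ℕ))))) *
          ((L / 2) ^ d : ℕ) * variance (fun g => (ρ g).trace.re) (haarProbability G)) * β ^ 2 / 4) /
        ((2 * N * Fintype.card (Plaquette d L)) ^ 2 * C) - 1 / 2 ≤
      tauInt (fun n => (∫ U, (wilsonAction ρ U - ∫ V, wilsonAction ρ V ∂(wilsonMeasure (d := d) (L := L) ρ β)) *
          ((imhOp (trivialMeasure G d L)
            (fun U => exp (β * (-wilsonAction ρ U)) / mgf (fun U => -wilsonAction ρ U) (trivialMeasure G d L) β)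
            q)^[n] (fun U => wilsonAction ρ U -
              ∫ V, wilsonAction ρ V ∂(wilsonMeasure (d := d) (L := L) ρ β))) U
          ∂(wilsonMeasure (d := d) (L := L) ρ β)) /
        variance (wilsonAction (d := d) (L := L) ρ) (wilsonMeasure (d := d) (L := L) ρ β)) := by
  haveI := isProbabilityMeasure_wilsonMeasure (d := d) (L := L) ρ hρ β
  set mS : ℝ := ∫ V, wilsonAction ρ V ∂(wilsonMeasure (d := d) (L := L) ρ β) with hmS
  set m : ℝ := Real.exp (-(β * (2 * N * ((d + 1) * d ^ 2 : ℕ) * (1 + 4 * ((d + 1) * d ^ 2 : ℕ))))) *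
    ((L / 2) ^ d : ℕ) * variance (fun g => (ρ g).trace.re) (haarProbability G) with hm
  -- the GEN-9 floor `m ≤ Var_β(S_W)`, and `m > 0`
  have hfloor : m ≤ variance (wilsonAction (d := d) (L := L) ρ) (wilsonMeasure (d := d) (L := L) ρ β) := by
    have h := wilson_variance_ge_allCouplings (d := d) (L := L) ρ hd hL hρ hρu β
    rwa [abs_of_nonneg hβ] at h
  have hLd : 0 < ((L / 2) ^ d : ℕ) := by
    have : 1 ≤ L / 2 := Nat.le_div_iff_mul_le (by norm_num) |>.2 (by omega)
    exact pow_pos (by omega) d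
  have hm0 : 0 < m := by
    rw [hm]
    refine mul_pos (mul_pos (exp_pos _) ?_) hv
    exact_mod_cast hLd
  -- the centred action is bounded, centred, with second moment the variance
  have hgm : Measurable fun U : GaugeConfig d L G => wilsonAction ρ U - mS :=
    (continuous_wilsonAction_of_continuous ρ hρ).measurable.sub_const _
  have hgb : ∀ U : GaugeConfig d L G, |wilsonAction ρ U - mS| ≤ 2 * N * Fintype.card (Plaquette d L) :=
    fun U => wilson_centredAction_bounded ρ hρ β U
  have hsq : ∫ U, (wilsonAction ρ U - mS) ^ 2 ∂(wilsonMeasure (d := d) (L := L) ρ β) =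
      variance (wilsonAction (d := d) (L := L) ρ) (wilsonMeasure (d := d) (L := L) ρ β) :=
    wilson_centredAction_sq_integral ρ hρ β
  have hpos : 0 < ∫ U, (wilsonAction ρ U - mS) ^ 2 ∂(wilsonMeasure (d := d) (L := L) ρ β) := by
    rw [hsq]; exact hm0.trans_le hfloor
  have hint : Integrable (wilsonAction (d := d) (L := L) ρ) (wilsonMeasure (d := d) (L := L) ρ β) :=
    Integrable.of_bound (continuous_wilsonAction_of_continuous ρ hρ).aestronglyMeasurable
      (2 * N * Fintype.card (Plaquette d L)) (ae_of_all _ fun V => by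
        rw [Real.norm_eq_abs]; exact WilsonPinching.abs_wilsonAction_le ρ hρ V)
  have hg0 : ∫ U, (wilsonAction ρ U - mS) ∂(wilsonMeasure (d := d) (L := L) ρ β) = 0 := by
    rw [integral_sub hint (integrable_const _), integral_const, probReal_univ, hmS]
    simp
  have h := wilson_flow_tauInt_ge_allCouplings (d := d) (L := L) ρ hd hL hρ hρu hβ hqm hq0 hqC hq1 hC
    hgm hgb hg0 hpos
  rw [hsq] at h
  refine le_trans (sub_le_sub_right ?_ _) h
  -- monotonicity in `E_β[g²] = Var_β(S_W) ≥ m`: `m·e^{mβ²/4} ≤ Var·e^{Var·β²/4}`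
  have hC0 : 0 < C := (hq0 (Classical.arbitrary _)).trans_le (hqC _)
  have hden : 0 < (2 * (N : ℝ) * Fintype.card (Plaquette d L)) ^ 2 * C := by
    have hNP : 0 < (2 * (N : ℝ) * Fintype.card (Plaquette d L)) ^ 2 := by
      have hb := hgb (Classical.arbitrary _)
      rcases (sq_nonneg (2 * (N : ℝ) * Fintype.card (Plaquette d L))).eq_or_lt with h0 | h0
      · exfalso
        have hz : 2 * (N : ℝ) * Fintype.card (Plaquette d L) = 0 := sq_eq_zero_iff.1 h0.symm
        have hg : ∀ U : GaugeConfig d L G, wilsonAction ρ U - mS = 0 := fun U =>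
          abs_nonpos_iff.1 (hz ▸ hgb U)
        simp only [hg, ne_eq, OfNat.ofNat_ne_zero, not_false_eq_true, zero_pow, integral_zero,
          lt_self_iff_false] at hpos
      · exact h0
    exact mul_pos hNP hC0
  rw [div_le_div_iff_of_pos_right hden]
  exact mul_le_mul_of_nonneg_right hfloor (exp_pos _).le


end Wilson

end Summit.Ventures.LatticeQCDFlow.TrivializingMaps

end
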